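import Literature.AlgebraicGeometry.Frobenioids.Cor411iiBiratApexSetting
import Literature.AlgebraicGeometry.Frobenioids.Cor411iiReductions
import Literature.AlgebraicGeometry.Frobenioids.Cor411iiPerfectionReduction
import Literature.AlgebraicGeometry.Frobenioids.PreFrobenioidDataToFunctor
import Literature.AlgebraicGeometry.Frobenioids.PerfectionStandardTypes
import Literature.AlgebraicGeometry.Frobenioids.ArithmeticFrobenioidPerfectionDivSlim
import HarnessLib

/-!
# Frobenioids I, Corollary 4.11 (ii) — ASSEMBLY: general Frobenioids from the reduced case along
# `C_i → C_i^istr → (C_i^istr)^pf`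

Mochizuki, *The geometry of Frobenioids I: the general theory*, Kyushu J. Math. **62** (2008)
293–400, Cor. 4.11 (ii) p. 91; the reductions of its proof p. 92 ll. 22–28 ("we may assume without loss
of generality that `C₁, C₂` are of isotropic type [cf. Remark 4.5.1] … not of group-like type") and of the
proof of Thm. 4.2 it invokes, p. 78 l. 41 ("by passing to perfections") [cite: MochizukiFrdI2008, Cor. 4.11 (ii) p.91].

PROOF-ONLY file (seat abc-iut-L1-d6, cell sub-DAG S2 `plan/L1/SUBDAG-FrdI-Cor411.md`): the typed
`(ofFunctor Φ₁ F₁).Cor411ii (ofFunctor Φ₂ F₂) Ψ` for Frobenioids `C_i → F_{Φ_i}` of quasi-isotropic type, from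
the INPUTS AT THE PERFECTIONS OF THE ISOTROPIC PARTS, `(C_i^istr)^pf` (the tree's `PreFrobenioid.Istr`,
`istrFunctor`, `isotropification`, seat abc-iut-L1-t1; `PreFrobenioid.Perfection`, `Perfection.ops`, `toPf`,
`Perfection.map`, seats abc-iut-L1-d9/d1 lineages), where the Frobenioids are of perfect and isotropic type
and `FrdI.T42.cor411ii_inst_of_setting` (this seat) applies:
* `cor411ii_of_istr_pf` — given `Ψ^istr` over `Ψ` along the isotropifications (Thm. 3.4 (i)), compatible with
  arrows of Frobenius type (Thm. 3.4 (iii)), an equivalence `Ψ^pf` of the perfections whose functor is THE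
  `Perfection.map` of `Ψ^istr`, a `FrdI.T42.Setting` for it (in particular: "`(C_i^istr)^pf` is a Frobenioid",
  Prop. 3.2 (iii); perfect, isotropic; `Φ_i^pf` perf-factorial; Thm. 3.4 (ii)(iii) for `Ψ^pf`), the Frobenioid
  structures of the birationalizations (Prop. 4.4 (ii)) with `HasBiratSquares`, and Thm. 4.2 (i) ("primary
  pre-steps") for `Ψ^pf` — the typed Cor. 4.11 (ii) holds for `Ψ` under its own hypotheses `Cor411Setting`
  (`D_i` Div-slim, `C_i` of standard type): base square at `(C_i^istr)^pf` (`exists_base_equivalence_inst_of_setting`;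
  the base data there — FSMFF, `Φ_i^pf` non-dilating, Div-slim relative to `Φ_i^pf` — come from `Cor411Setting`
  by `Perfection.isNonDilatingOn_ops`, seat abc-iut-w5 lineage, and `Perfection.ops_isDivSlim_of`, seat
  abc-iut-L1 lineage), descended along `C_i^istr → (C_i^istr)^pf` (`exists_base_equivalence_of_pf`) and along
  `C_i → C_i^istr` (`cor411ii_of_istr`).
Every hypothesis is a typed predicate of the tree at the named objects (no `Prop` placeholders); they are the
residual inputs of the node, each the conclusion of a printed result typed elsewhere in the cell. No new
definitions; nothing of the paper is restated; nothing here is specific to the abc programme.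
-/

namespace Literature.AlgebraicGeometry.Frobenioids

open CategoryTheory Opposite

universe w v v' u u'

namespace PreFrobenioid

variable {D₁ : Type u} [Category.{v} D₁] {Φ₁ : D₁ᵒᵖ ⥤ CommMonCat.{w}}
  {C₁ : Type u'} [Category.{v'} C₁] {F₁ : C₁ ⥤ ElemFrobenioid Φ₁}
  {D₂ : Type u} [Category.{v} D₂] {Φ₂ : D₂ᵒᵖ ⥤ CommMonCat.{w}}
  {C₂ : Type u'} [Category.{v'} C₂] {F₂ : C₂ ⥤ ElemFrobenioid Φ₂}

set_option backward.isDefEq.respectTransparency false in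
/-- **[FrdI] Cor. 4.11 (ii) for general Frobenioids, assembled from the reduced case at the perfections of the
isotropic parts** (proof of Cor. 4.11, p. 92 ll. 22–28; proof of Thm. 4.2, p. 78 l. 41), under the hypotheses
of Cor. 4.11 (`Cor411Setting`: `D_i` Div-slim, `C_i` of standard type — whence quasi-isotropic, FSMFF bases,
`Φ_i` non-dilating). Data: `Ψ^istr` (`Ψi`) over `Ψ` along the isotropifications (`core`, Thm. 3.4 (i)),
compatible with arrows of Frobenius type (`hΨi`, Thm. 3.4 (iii)); `Ψ^pf` (`Ψp`) an equivalence of the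
perfections `(C_i^istr)^pf` whose functor is `Perfection.map hΨi` (`hΨp`). Residual hypotheses at
`(C_i^istr)^pf → F_{Φ_i^pf}` (`(Perfection.ops _).toFunctor`): a `FrdI.T42.Setting` for `Ψ^pf` (it carries
"`(C_i^istr)^pf` is a Frobenioid", Prop. 3.2 (iii), perfect and isotropic type, `Φ_i^pf` perf-factorial, and the
clauses of Thm. 3.4 (ii)(iii) for `Ψ^pf`), `HasBiratSquares` and the Frobenioid structures of the
birationalizations (Prop. 4.4 (ii)), and "`Ψ^pf`, `(Ψ^pf)⁻¹` preserve primary pre-steps" (Thm. 4.2 (i)).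
Conclusion: the typed Cor. 4.11 (ii) for `Ψ`. [cite: MochizukiFrdI2008, Cor. 4.11 (ii) p.91] -/
theorem cor411ii_of_istr_pf (hF₁ : IsFrobenioid F₁) (hF₂ : IsFrobenioid F₂) (Ψ : C₁ ≌ C₂)
    (hs : (PreFrobenioidData.ofFunctor Φ₁ F₁).Cor411Setting (PreFrobenioidData.ofFunctor Φ₂ F₂) Ψ)
    (Ψi : Istr F₁ ≌ Istr F₂) (core : isotropification hF₁ ⋙ Ψi.functor ≅ Ψ.functor ⋙ isotropification hF₂)
    (hΨi : IsFrobeniusCompatible (istrFunctor F₁) (istrFunctor F₂) Ψi.functor)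
    (Ψp : Perfection (isFrobenioid_istr hF₁) ≌ Perfection (isFrobenioid_istr hF₂))
    (hΨp : Ψp.functor = Perfection.map (hF₁ := isFrobenioid_istr hF₁) (hF₂ := isFrobenioid_istr hF₂) hΨi)
    (S : FrdI.T42.Setting (Perfection.ops (isFrobenioid_istr hF₁)).toFunctor
      (Perfection.ops (isFrobenioid_istr hF₂)).toFunctor Ψp)
    (hsq₁ : HasBiratSquares (Perfection.ops (isFrobenioid_istr hF₁)).toFunctor)
    (hsq₂ : HasBiratSquares (Perfection.ops (isFrobenioid_istr hF₂)).toFunctor)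
    (hB₁ : IsFrobenioid (Birat.toElemZero S.isFrobenioid₁ hsq₁))
    (hB₂ : IsFrobenioid (Birat.toElemZero S.isFrobenioid₂ hsq₂))
    (hprim : ∀ ⦃X Y : Perfection (isFrobenioid_istr hF₁)⦄ (φ : X ⟶ Y),
      IsPrimaryPreStep (Perfection.ops (isFrobenioid_istr hF₁)).toFunctor φ →
        IsPrimaryPreStep (Perfection.ops (isFrobenioid_istr hF₂)).toFunctor (Ψp.functor.map φ))
    (hprim' : ∀ ⦃X Y : Perfection (isFrobenioid_istr hF₂)⦄ (φ : X ⟶ Y),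
      IsPrimaryPreStep (Perfection.ops (isFrobenioid_istr hF₂)).toFunctor φ →
        IsPrimaryPreStep (Perfection.ops (isFrobenioid_istr hF₁)).toFunctor (Ψp.inverse.map φ)) :
    (PreFrobenioidData.ofFunctor Φ₁ F₁).Cor411ii (PreFrobenioidData.ofFunctor Φ₂ F₂) Ψ := by
  have hI₁ := isFrobenioid_istr hF₁
  have hI₂ := isFrobenioid_istr hF₂
  -- the base data at `(C_i^istr)^pf` from `Cor411Setting`: FSMFF, `Φ_i^pf` non-dilating, Div-slim w.r.t. `Φ_i^pf`
  have hD₁ : IsOfFSMFFType D₁ := hs.standard.1.fsmff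
  have hD₂ : IsOfFSMFFType D₂ := hs.standard.2.fsmff
  have hndI₁ : (PreFrobenioidData.ofFunctor Φ₁ (istrFunctor F₁)).IsNonDilatingOn := ⟨hs.standard.1.nonDilating.nonDilating⟩
  have hndI₂ : (PreFrobenioidData.ofFunctor Φ₂ (istrFunctor F₂)).IsNonDilatingOn := ⟨hs.standard.2.nonDilating.nonDilating⟩
  have hnd₁ : IsNonDilatingOn (Perfection.ops hI₁).monFunctor := fun X f =>
    (PreFrobenioidData.isNonDilating_iff_isNonDilating _).mp
      ((Perfection.isNonDilatingOn_ops hI₁ hndI₁).nonDilating X f)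
  have hnd₂ : IsNonDilatingOn (Perfection.ops hI₂).monFunctor := fun X f =>
    (PreFrobenioidData.isNonDilating_iff_isNonDilating _).mp
      ((Perfection.isNonDilatingOn_ops hI₂ hndI₂).nonDilating X f)
  have hdsI₁ : (PreFrobenioidData.ofFunctor Φ₁ (istrFunctor F₁)).IsDivSlim := ⟨hs.divSlim.1.eq_one⟩
  have hdsI₂ : (PreFrobenioidData.ofFunctor Φ₂ (istrFunctor F₂)).IsDivSlim := ⟨hs.divSlim.2.eq_one⟩
  have hds₁ : (Perfection.ops hI₁).IsDivSlim :=
    Perfection.ops_isDivSlim_of hI₁ hI₁.isPreFrobenioid.isDivisorial hdsI₁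
  have hds₂ : (Perfection.ops hI₂).IsDivSlim :=
    Perfection.ops_isDivSlim_of hI₂ hI₂.isPreFrobenioid.isDivisorial hdsI₂
  -- the base square at `(C_i^istr)^pf` (perfect, isotropic: the apex over `FrdI.T42.Setting`)
  have hpf := FrdI.T42.exists_base_equivalence_inst_of_setting S hsq₁ hsq₂ hB₁ hB₂ hD₁ hD₂ hnd₁ hnd₂
    hds₁ hds₂ hprim hprim'
  -- read it for THE `Perfection.map` of `Ψ^istr` over the operations of the perfections
  have hpf' : ∃ ΨBase : D₁ ⥤ D₂, ΨBase.IsEquivalence ∧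
      OneCommutes (Perfection.map (hF₁ := hI₁) (hF₂ := hI₂) hΨi)
        (Perfection.ops hI₂).base (Perfection.ops hI₁).base ΨBase := by
    rw [← hΨp]
    exact hpf
  -- descend along `C_i^istr → (C_i^istr)^pf` and along `C_i → C_i^istr`
  exact cor411ii_of_istr hF₁ hF₂ Ψ Ψi core (exists_base_equivalence_of_pf hI₁ hI₂ Ψi hΨi hpf')

/-- **The same with THE `Ψ^istr` of Thm. 3.4 (i)** — the restriction of `Ψ` to the isotropic objects
(`Ψ.congrFullSubcategory`, Thm. 3.4 (i) seat abc-iut-L1-t13's `isotropicObjects_inverseImage`; it lies over `Ψ`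
along the isotropifications by uniqueness of left adjoints, seat abc-iut-w4-d088's
`nonempty_isotropification_comp_iso`), so that only `Ψ^pf` and the inputs at the perfections remain as data.
[cite: MochizukiFrdI2008, Cor. 4.11 (ii) p.91] -/
theorem cor411ii_of_congr_istr_pf (hF₁ : IsFrobenioid F₁) (hF₂ : IsFrobenioid F₂) (Ψ : C₁ ≌ C₂)
    (hs : (PreFrobenioidData.ofFunctor Φ₁ F₁).Cor411Setting (PreFrobenioidData.ofFunctor Φ₂ F₂) Ψ)
    [(isotropicObjects F₂).IsClosedUnderIsomorphisms]
    (hΨi : IsFrobeniusCompatible (istrFunctor F₁) (istrFunctor F₂)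
      (Ψ.congrFullSubcategory (FrdI.isotropicObjects_inverseImage hF₁ hs.standard.1.quasiIsotropic
        hs.standard.2.quasiIsotropic Ψ)).functor)
    (Ψp : Perfection (isFrobenioid_istr hF₁) ≌ Perfection (isFrobenioid_istr hF₂))
    (hΨp : Ψp.functor = Perfection.map (hF₁ := isFrobenioid_istr hF₁) (hF₂ := isFrobenioid_istr hF₂) hΨi)
    (S : FrdI.T42.Setting (Perfection.ops (isFrobenioid_istr hF₁)).toFunctor
      (Perfection.ops (isFrobenioid_istr hF₂)).toFunctor Ψp)
    (hsq₁ : HasBiratSquares (Perfection.ops (isFrobenioid_istr hF₁)).toFunctor)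
    (hsq₂ : HasBiratSquares (Perfection.ops (isFrobenioid_istr hF₂)).toFunctor)
    (hB₁ : IsFrobenioid (Birat.toElemZero S.isFrobenioid₁ hsq₁))
    (hB₂ : IsFrobenioid (Birat.toElemZero S.isFrobenioid₂ hsq₂))
    (hprim : ∀ ⦃X Y : Perfection (isFrobenioid_istr hF₁)⦄ (φ : X ⟶ Y),
      IsPrimaryPreStep (Perfection.ops (isFrobenioid_istr hF₁)).toFunctor φ →
        IsPrimaryPreStep (Perfection.ops (isFrobenioid_istr hF₂)).toFunctor (Ψp.functor.map φ))
    (hprim' : ∀ ⦃X Y : Perfection (isFrobenioid_istr hF₂)⦄ (φ : X ⟶ Y),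
      IsPrimaryPreStep (Perfection.ops (isFrobenioid_istr hF₂)).toFunctor φ →
        IsPrimaryPreStep (Perfection.ops (isFrobenioid_istr hF₁)).toFunctor (Ψp.inverse.map φ)) :
    (PreFrobenioidData.ofFunctor Φ₁ F₁).Cor411ii (PreFrobenioidData.ofFunctor Φ₂ F₂) Ψ := by
  obtain ⟨core⟩ := nonempty_isotropification_comp_iso hF₁ hF₂ hs.standard.1.quasiIsotropic
    hs.standard.2.quasiIsotropic Ψ
  exact cor411ii_of_istr_pf hF₁ hF₂ Ψ hs _ core hΨi Ψp hΨp S hsq₁ hsq₂ hB₁ hB₂ hprim hprim'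

end PreFrobenioid

end Literature.AlgebraicGeometry.Frobenioids
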